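import Mathlib
import HarnessLib
import Literature.MathematicalPhysics.QuantumFieldTheory.Sweep1AreaLawProofs

/-!
# Packaging of the `q`-Lipschitz constants of the fine tuning ([ABKM19] Lemma 12.6 (12.52)–(12.53)):
# the closeness parameter `τ(1+τ)` is linear in `|q − q'|`, and local Lipschitz bounds globalise on a ball

Two pieces of real arithmetic used when the kernel-level estimates of this tree
(`abs_re_fourierCoeff_one_add_sub_le_of_torusFRD`: closeness `δ = τ(1+τ)` whenever
`K·|q'−q| ≤ log(1+τ)`; `tayNormLE_fluct_sub_fluct_of_torusFRD`, `hamNorm_opB_sub_abkm_le`: bounds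
`∝ δ` valid while `δ ≤ 1/(16 q_H)`) are turned into the hypotheses `hb`, `hl` of
`RGFlow.exists_isTunedQ_initial_eq_of_finiteDimensional` (a Lipschitz bound `∝ ‖h − h'‖` for ALL
`h, h'` in the ball, arbitrary constant):

* **`exp_mul_sub_one_mul_le`** — with `τ = e^{Kt} − 1` (so that `log(1+τ) = Kt`):
  `τ(1+τ) ≤ K e^{2KT₁} · t` for `0 ≤ t ≤ T₁`, `K ≥ 0` (`e^x − 1 ≤ x e^x`, the tree's `AreaLaw.exp_sub_one_le_mul_exp`);
  `log_one_add_exp_mul_sub_one` — `log(1 + (e^{Kt} − 1)) = Kt`;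
* **`le_max_mul_of_local_lipschitz`** — if `D ≤ Λ t` whenever `t ≤ T₁` (`T₁ > 0`) and `D ≤ B`
  always, then `D ≤ max Λ (B/T₁) · t` for every `t ≥ 0` with (`t ≤ T₁` or `T₁ ≤ t`): the crude
  far-field bound globalises a local Lipschitz estimate without chaining.

Everything is proved; no named fact.

## References
* S. Adams, S. Buchholz, R. Kotecký, S. Müller, arXiv:1910.13564, Lemma 12.6 (12.52)–(12.56)
  [AdamsBuchholzKoteckyMuller2019].
-/

noncomputable section

namespace Literature.MathematicalPhysics.StatisticalMechanics.GradientRG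

open Real

/-- `log(1 + (e^{Kt} − 1)) = Kt`: the choice `τ = e^{Kt} − 1` meets `K t ≤ log(1+τ)` with equality.
[cite: AdamsBuchholzKoteckyMuller2019, Lemma 7.7 (7.75)] -/
theorem log_one_add_exp_mul_sub_one (K t : ℝ) : Real.log (1 + (Real.exp (K * t) - 1)) = K * t := by
  rw [add_sub_cancel, Real.log_exp]

/-- `e^{Kt} − 1 ≥ 0` for `K, t ≥ 0`. [cite: AdamsBuchholzKoteckyMuller2019, Lemma 7.7 (7.75)] -/
theorem exp_mul_sub_one_nonneg {K t : ℝ} (hK : 0 ≤ K) (ht : 0 ≤ t) : 0 ≤ Real.exp (K * t) - 1 := by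
  have : 1 ≤ Real.exp (K * t) := Real.one_le_exp (mul_nonneg hK ht)
  linarith

/-- **The closeness parameter is linear in `t = |q − q'|`**: with `τ = e^{Kt} − 1`,
`τ(1+τ) ≤ K e^{2KT₁} · t` for `0 ≤ t ≤ T₁`, `K ≥ 0`. [cite: AdamsBuchholzKoteckyMuller2019, Lemma 12.6 (12.52)] -/
theorem exp_mul_sub_one_mul_le {K t T₁ : ℝ} (hK : 0 ≤ K) (ht : 0 ≤ t) (htT : t ≤ T₁) :
    (Real.exp (K * t) - 1) * (1 + (Real.exp (K * t) - 1)) ≤ K * Real.exp (2 * K * T₁) * t := by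
  have hx : 0 ≤ K * t := mul_nonneg hK ht
  have h1 : Real.exp (K * t) - 1 ≤ K * t * Real.exp (K * t) :=
    Literature.MathematicalPhysics.QuantumFieldTheory.AreaLaw.exp_sub_one_le_mul_exp _
  have h2 : Real.exp (K * t) ≤ Real.exp (K * T₁) := Real.exp_le_exp.2 (mul_le_mul_of_nonneg_left htT hK)
  have h3 : Real.exp (K * T₁) * Real.exp (K * T₁) = Real.exp (2 * K * T₁) := by
    rw [← Real.exp_add]; congr 1; ring
  have he0 : 0 < Real.exp (K * t) := Real.exp_pos _
  calc (Real.exp (K * t) - 1) * (1 + (Real.exp (K * t) - 1))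
      = (Real.exp (K * t) - 1) * Real.exp (K * t) := by ring
    _ ≤ (K * t * Real.exp (K * t)) * Real.exp (K * t) := mul_le_mul_of_nonneg_right h1 he0.le
    _ = K * t * (Real.exp (K * t) * Real.exp (K * t)) := by ring
    _ ≤ K * t * (Real.exp (K * T₁) * Real.exp (K * T₁)) :=
        mul_le_mul_of_nonneg_left (mul_le_mul h2 h2 he0.le (Real.exp_pos _).le) hx
    _ = K * Real.exp (2 * K * T₁) * t := by rw [h3]; ring

/-- **Local Lipschitz bounds globalise on a ball with the crude far-field bound**: if `D ≤ Λ t` for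
`t ≤ T₁` (`T₁ > 0`) and `D ≤ B` (`B ≥ 0`), then `D ≤ max Λ (B / T₁) · t` for every `t ≥ 0`.
[cite: AdamsBuchholzKoteckyMuller2019, Lemma 12.6 (12.56)] -/
theorem le_max_mul_of_local_lipschitz {D Λ B T₁ t : ℝ} (hT₁ : 0 < T₁) (hB : 0 ≤ B) (ht : 0 ≤ t)
    (hloc : t ≤ T₁ → D ≤ Λ * t) (hfar : D ≤ B) : D ≤ max Λ (B / T₁) * t := by
  rcases le_or_gt t T₁ with h | h
  · exact (hloc h).trans (mul_le_mul_of_nonneg_right (le_max_left _ _) ht)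
  · have h1 : B ≤ B / T₁ * t := by
      rw [div_mul_eq_mul_div, le_div_iff₀ hT₁]
      exact mul_le_mul_of_nonneg_left h.le hB
    exact hfar.trans (h1.trans (mul_le_mul_of_nonneg_right (le_max_right _ _) ht))

end Literature.MathematicalPhysics.StatisticalMechanics.GradientRG

end
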